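import Summits.NavierStokesRegularity.NavierStokesRegularity.Theorems.ScenarioCensusRowF1ax
import Summits.NavierStokesRegularity.NavierStokesRegularity.Theorems.ScenarioCensusRowA7h
import Summits.NavierStokesRegularity.NavierStokesRegularity.Theorems.DssFarFieldSlavingBlowupTypeIDssProfileSimilarityEnstrophyBeltramiLiouville
import Summits.NavierStokesRegularity.NavierStokesRegularity.Theorems.SqueezeCycleSingularZoomWindow
import Summits.NavierStokesRegularity.NavierStokesRegularity.Theorems.ClockStretchingLawClockCeilingZoomDerivLimit
import Summits.NavierStokesRegularity.NavierStokesRegularity.Theorems.PoloidalWindowDoorPoloidalWindowRigidityVorticityTranslate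
import Summits.NavierStokesRegularity.NavierStokesRegularity.Theorems.HalfSpaceWindowDoorCirculationCarryingRigidityWholeSpaceMaxPrinciple
import Literature.Analysis.FluidPDE.TypeIAncientMild
import Literature.Analysis.FluidPDE.WholeSpaceIBP
import Literature.Analysis.FluidPDE.ClassicalSolutionCalculus
import Literature.Analysis.FluidPDE.VorticityEquation
import Literature.Analysis.FluidPDE.TypeIAncientMildClassical
import Summits.NavierStokesRegularity.NavierStokesRegularity.Theorems.DssFarFieldSlavingBlowupTypeIDssProfileSimilarityEnstrophyCrossFlowNoDecayOne
import Summits.NavierStokesRegularity.NavierStokesRegularity.Theorems.DssFarFieldSlavingBlowupTypeIDssProfileSimilarityEnstrophyTimeOnlyThreshold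
import HarnessLib
import Summits.NavierStokesRegularity.NavierStokesRegularity.Theorems.ScenarioCensusRowF1SharpTopCrit
import Summits.NavierStokesRegularity.NavierStokesRegularity.Theorems.ScenarioCensusRowF1SocketKill

/-!
# Census row F1, the VOLUME AXIS of the critical top (cells F1th / F1vo / F1ps / F1wk; floors RFS / PFS / DTH / PWC) — LINE 29 «thin-top» port, part 1/3: §6 SLICE VOLUMES OF
# THE CRITICAL TOP — the `κ`-fast slice, the parabolic volume unit, the fast fraction `Φ_κ`, the `δ`-fat times, scale-nullity; measurability; the two changes of
# variables; Fatou for sets; THE SLICE-VOLUME TRANSFER `slow_everywhere_of_scaleNull`; the kill (imported).  §1–§5 of the line are LINE 27/28 VERBATIM and are taken BY NAME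
# from the landed liouville-socket / sharp-top ports (`open …LiouvilleSocket …SharpTop`; not re-declared)

Re-homed for the scenario census (typer seat ns-census-typer-1 g9; the cells F1th / F1vo / F1ps (+ F1wk) and the floors are MEMBERS OF RECORD «DECIDED IN KERNEL IN FILES»
of row F1 since census v1.92 (critic idea-crit-3 g8 PASS 06:25:46Z — no price; ref ns-census-ref g11 PRE-CHECK ✓ §16.23 item 56; lead-presearch label); this port
makes them TREE-decided): VERBATIM PORT of the NEW sections (§6–§9) of ns-idea-3 LINE 29 «thin-top», `pub/ideators/ns-idea-3/lines/thin-top/line-thin-top.lean` sha16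
4cd0e2efd2dcc4d5 (1617 l., lean check rc 0, 0 sorry; its §1–§5 = LINE 27/28 VERBATIM, taken BY NAME from `ScenarioCensusRowF1Socket*` / `…SharpTop*`), split for the
400-line rule into `ScenarioCensusRowF1ThinTop` (§6) → `…ThinTopRows` (§7) → `…ThinTopVolume` (§8–§9 + census KEYS).  Lean text VERBATIM in namespace
`…Theorems.ScenarioCensus.ThinTop` (the line's `…Cruxes.ScenarioCensusRowF1.ThinTopLine` re-homed) with `open …LiouvilleSocket …SharpTop`; port edits: the bracket lines
`section …` / `end …` dropped (no `variable`s), §8's VERBATIM restatement of LINE 27's `volIntegrand` / `Row_F1vol` / `volIntegrand_mono` / `rowF1vol_holds` not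
re-declared (BY NAME), `@[conjecture]` on the residual `ThinSlack` (≡ `ScenarioCensus.Row_F1`, OPEN), one-line docstrings added where missing (gate lint).  Statements
untouched.

No census VALUE is moved here (row F1 stays OPEN-WITH-LINE; the members become TREE-decided by name); NS regularity is NOT proved; `Row_F1` is untouched (zero
movement, `thinSlack_iff_rowF1`); no summit statement is proved by this file. Lemmas that restate already-landed tree declarations are taken BY NAME (gate lint `dedup.landed`): `fderiv_smul_stPull_apply` = `InviscidTop.fderiv_smul_stPull_apply`, `fderiv_smul_stPull` = `InviscidTop.fderiv_smul_stPull`, `fderiv_fderiv_smul_stPull` = `InviscidTop.fderiv_fderiv_smul_stPull`, `tendsto_clm_of_tendsto_apply` = `InviscidTop.tendsto_clm_of_tendsto_apply`, `tendsto_fderiv_fderiv_apply_of_bound` = `InviscidTop.tendsto_fderiv_fderiv_apply_of_bound`, `tendsto_fderiv_fderiv_of_bound` = `InviscidTop.tendsto_fderiv_fderiv_of_bound`, `tendsto_fderiv_fderiv_of_typeI_seq_Ioo` = `InviscidTop.tendsto_fderiv_fderiv_of_typeI_seq_Ioo`, `fderiv3_smul_stPull` = `FrozenTop.fderiv3_smul_stPull`,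 `tendsto_fderiv3_of_typeI_seq_Ioo` = `FrozenTop.tendsto_fderiv3_of_typeI_seq_Ioo`, `tendsto_physicalTime` = `ColumnarTop.tendsto_physicalTime`, `eventually_fast` = `ColumnarTop.eventually_fast`, `sqrt_timeLag` = `StretchedTop.sqrt_timeLag`, `forall_of_forall_ne_zero` = `StretchedTop.forall_of_forall_ne_zero`, `radius_eq` = `FrozenTop.radius_eq`, `jointCond_everywhere₆` = `FrozenTop.jointCond_everywhere₄`, `continuousOn_quad` = `IntegratedStretch.continuousOn_quad`, `sqrt_nu_timeLag` = `IntegratedStretch.sqrt_nu_timeLag`, `sing_of_not_bounded` = `InviscidTop.sing_of_not_bounded`, `exists_singularZoom_package₃` = `FrozenTop.exists_singularZoom_package₃`, `lapD_eq_zero_of_eq_zero` = `FrozenTop.lapD_eq_zero_of_eq_zero`, `measurableSet_top` = `IntegratedStretch.measurableSet_top`, `cross_smul_smul` = `UnthreadedRigidity.ThreadingJets.cross_smul_smul`.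
-/

-- the summit and its single problem share the name `NavierStokesRegularity` (D-0017 nested layout)
set_option linter.dupNamespace false

noncomputable section

open MeasureTheory Set Function Filter TopologicalSpace Metric
open scoped Topology NNReal ENNReal InnerProductSpace RealInnerProductSpace Laplacian

namespace Summit.NavierStokesRegularity.NavierStokesRegularity.Theorems.ScenarioCensus.ThinTop

open Literature.Analysis Literature.Analysis.FluidPDE
open Summit.NavierStokesRegularity.NavierStokesRegularity.Theorems
open Summit.NavierStokesRegularity.NavierStokesRegularity.Theorems.ScenarioCensus.LiouvilleSocket
open Summit.NavierStokesRegularity.NavierStokesRegularity.Theorems.ScenarioCensus.SharpTop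

/-! ## §6 SLICE VOLUMES OF THE CRITICAL TOP (NEW in LINE 29): the `κ`-fast slice, the parabolic volume unit, the
volume FRACTION `Φ_κ(t)`, the `δ`-FAT TIMES, and NULLITY IN EVERY SCALE WINDOW at `T` -/

/-- The `κ`-FAST SLICE at time `t`: `F^κ_t = {x : √(κν/(T − t)) < |u(t, x)|}` (`= {|u|² > κν/(T − t)}` for `κ ≥ 0`,
`critLevel_lt_norm_iff`). -/
def fastSlice (T ν κ : ℝ) (u : ℝ → E3 → E3) (t : ℝ) : Set E3 := {x | critLevel T ν κ t < ‖u t x‖}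

/-- The PARABOLIC VOLUME UNIT `(ν (T − t))^{3/2}` at time `t` (extended non-negative real). -/
def parabVol (T ν t : ℝ) : ℝ≥0∞ := ENNReal.ofReal (Real.sqrt (ν * (T - t)) ^ 3)

/-- The dimensionless VOLUME FRACTION of the `κ`-fast slice: `Φ_κ(t) = vol(F^κ_t) / (ν(T − t))^{3/2} ∈ [0, ∞]`. -/
def fastFraction (T ν κ : ℝ) (u : ℝ → E3 → E3) (t : ℝ) : ℝ≥0∞ := volume (fastSlice T ν κ u t) / parabVol T ν t

/-- The `δ`-FAT TIMES of the `κ`-fast slice: the `t ∈ [0, T)` at which `vol(F^κ_t) > δ (ν(T − t))^{3/2}`. -/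
def fatTimes (T ν κ δ : ℝ) (u : ℝ → E3 → E3) : Set ℝ :=
  {t | t ∈ Ico 0 T ∧ ENNReal.ofReal δ * parabVol T ν t < volume (fastSlice T ν κ u t)}

/-- A set of times `B` is NULL IN EVERY SCALE WINDOW at `T`: `vol(B ∩ [T − λb, T − λa]) / λ → 0` as `λ → 0⁺` for all
`0 < a < b` (equivalently: its density in `[T − 2h, T − h]` tends to `0`; weaker than `vol(B ∩ [t, T)) = o(T − t)` is NOT
claimed — it is the windowed form the zoom sees). -/
def IsScaleNull (T : ℝ) (B : Set ℝ) : Prop :=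
  ∀ a b : ℝ, 0 < a → a < b →
    Tendsto (fun l : ℝ => volume (B ∩ Icc (T - l * b) (T - l * a)) / ENNReal.ofReal l) (𝓝[>] 0) (𝓝 0)

/-! ### Elementary properties -/

/-- Scale-nullity passes to subsets. -/
theorem IsScaleNull.mono {T : ℝ} {B B' : Set ℝ} (h : B' ⊆ B) (hB : IsScaleNull T B) : IsScaleNull T B' := by
  intro a b ha hab
  refine tendsto_of_tendsto_of_tendsto_of_le_of_le tendsto_const_nhds (hB a b ha hab) (fun _ => bot_le)
    fun l => ?_
  exact ENNReal.div_le_div_right (measure_mono (inter_subset_inter_left _ h)) _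

/-- The empty set is scale-null. -/
theorem isScaleNull_empty (T : ℝ) : IsScaleNull T ∅ := by
  intro a b _ _
  simp only [empty_inter, measure_empty, ENNReal.zero_div]
  exact tendsto_const_nhds

/-- A set of times avoiding a final interval `(t₁, T]`… more precisely contained in `(-∞, t₁]` with `t₁ < T`, is
scale-null at `T` (late windows miss it). -/
theorem isScaleNull_of_subset_Iic {T t₁ : ℝ} (ht₁ : t₁ < T) {B : Set ℝ} (hB : B ⊆ Iic t₁) : IsScaleNull T B := by
  intro a b ha hab
  have hb : 0 < b := ha.trans hab
  have hev : ∀ᶠ l in 𝓝[>] (0 : ℝ), volume (B ∩ Icc (T - l * b) (T - l * a)) / ENNReal.ofReal l = 0 := by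
    have hmem : Ioo (0 : ℝ) ((T - t₁) / b) ∈ 𝓝[>] (0 : ℝ) := Ioo_mem_nhdsGT (div_pos (sub_pos.2 ht₁) hb)
    filter_upwards [hmem] with l hl
    have hlb : l * b < T - t₁ := (lt_div_iff₀ hb).1 hl.2
    have hempty : B ∩ Icc (T - l * b) (T - l * a) = ∅ := by
      ext t
      simp only [mem_inter_iff, mem_Icc, mem_empty_iff_false, iff_false, not_and, not_le]
      intro htB hlow
      have ht1 : t ≤ t₁ := hB htB
      linarith
    rw [hempty, measure_empty, ENNReal.zero_div]
  exact tendsto_const_nhds.congr' (EventuallyEq.symm hev)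

/-- The fast slice is ANTITONE in the fraction `κ` (for `t < T`). -/
theorem fastSlice_anti {κ₁ κ₂ : ℝ} (h : κ₁ ≤ κ₂) {T ν : ℝ} (hν : 0 ≤ ν) (u : ℝ → E3 → E3) {t : ℝ} (ht : t < T) :
    fastSlice T ν κ₂ u t ⊆ fastSlice T ν κ₁ u t :=
  fun _ hx => lt_of_le_of_lt (critLevel_mono h hν ht) hx

/-- The fat times are ANTITONE in the fraction `κ`. -/
theorem fatTimes_anti {κ₁ κ₂ : ℝ} (h : κ₁ ≤ κ₂) {T ν : ℝ} (hν : 0 ≤ ν) (δ : ℝ) (u : ℝ → E3 → E3) :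
    fatTimes T ν κ₂ δ u ⊆ fatTimes T ν κ₁ δ u := by
  rintro t ⟨ht, hlt⟩
  exact ⟨ht, lt_of_lt_of_le hlt (measure_mono (fastSlice_anti h hν u ht.2))⟩

/-- The parabolic volume unit is positive and finite before `T`. -/
theorem parabVol_pos {T ν t : ℝ} (hν : 0 < ν) (ht : t < T) : 0 < parabVol T ν t := by
  unfold parabVol
  exact ENNReal.ofReal_pos.2 (pow_pos (Real.sqrt_pos.2 (mul_pos hν (sub_pos.2 ht))) 3)

/-- The parabolic volume unit is finite. -/
theorem parabVol_ne_top (T ν t : ℝ) : parabVol T ν t ≠ ⊤ := ENNReal.ofReal_ne_top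

/-- Fatness read as a lower bound on the volume FRACTION: `t` is `δ`-fat iff `t ∈ [0,T)` and `δ < Φ_κ(t)` (`ν > 0`). -/
theorem mem_fatTimes_iff {T ν κ δ : ℝ} (hν : 0 < ν) {u : ℝ → E3 → E3} {t : ℝ} :
    t ∈ fatTimes T ν κ δ u ↔ t ∈ Ico 0 T ∧ ENNReal.ofReal δ < fastFraction T ν κ u t := by
  constructor
  · rintro ⟨ht, hlt⟩
    refine ⟨ht, ?_⟩
    unfold fastFraction
    rw [ENNReal.lt_div_iff_mul_lt (Or.inl (parabVol_pos hν ht.2).ne') (Or.inl (parabVol_ne_top _ _ _))]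
    exact hlt
  · rintro ⟨ht, hlt⟩
    refine ⟨ht, ?_⟩
    unfold fastFraction at hlt
    rw [ENNReal.lt_div_iff_mul_lt (Or.inl (parabVol_pos hν ht.2).ne') (Or.inl (parabVol_ne_top _ _ _))] at hlt
    exact hlt

/-! ### Measurability of the slice volume and of the fat times (Tonelli slices of the measurable space–time top) -/

/-- **The fat times are measurable**: on `[0, T)` the slice volume `t ↦ vol(F^κ_t)` is the (measurable, Tonelli)
slice-measure function of the measurable space–time top `{(t, x) : t ∈ [0,T), Λ♯(t) < |u(t, x)|}`. -/
theorem measurableSet_fatTimes {ν T : ℝ} {u : ℝ → E3 → E3} {p : ℝ → E3 → ℝ}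
    (hsol : IsClassicalNSSolutionOn (Ico 0 T) ν 0 u p) (κ δ : ℝ) : MeasurableSet (fatTimes T ν κ δ u) := by
  classical
  set S : Set (ℝ × E3) := {z : ℝ × E3 | z.1 ∈ Ico 0 T ∧ critLevel T ν κ z.1 < ‖u z.1 z.2‖} with hS
  have hSm : MeasurableSet S := IntegratedStretch.measurableSet_top hsol (measurable_critLevel T ν κ)
  have hslice : Measurable fun t : ℝ => volume (Prod.mk t ⁻¹' S) := measurable_measure_prodMk_left hSm
  have hpv0 : Measurable fun t : ℝ => parabVol T ν t := by
    unfold parabVol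
    exact ENNReal.measurable_ofReal.comp
      ((Real.continuous_sqrt.measurable.comp (measurable_const.mul (measurable_const.sub measurable_id))).pow_const 3)
  have hpv : Measurable fun t : ℝ => ENNReal.ofReal δ * parabVol T ν t := hpv0.const_mul _
  have heq : fatTimes T ν κ δ u = Ico 0 T ∩ {t | ENNReal.ofReal δ * parabVol T ν t < volume (Prod.mk t ⁻¹' S)} := by
    ext t
    simp only [fatTimes, mem_setOf_eq, mem_inter_iff]
    constructor
    · rintro ⟨ht, hlt⟩
      refine ⟨ht, ?_⟩
      have e : Prod.mk t ⁻¹' S = fastSlice T ν κ u t := by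
        ext x; simp only [hS, mem_preimage, mem_setOf_eq, fastSlice]; exact ⟨fun h => h.2, fun h => ⟨ht, h⟩⟩
      rw [e]; exact hlt
    · rintro ⟨ht, hlt⟩
      refine ⟨ht, ?_⟩
      have e : Prod.mk t ⁻¹' S = fastSlice T ν κ u t := by
        ext x; simp only [hS, mem_preimage, mem_setOf_eq, fastSlice]; exact ⟨fun h => h.2, fun h => ⟨ht, h⟩⟩
      rw [← e]; exact hlt
  rw [heq]
  exact measurableSet_Ico.inter (measurableSet_lt hpv hslice)

/-! ### Two changes of variables for Lebesgue measure: the space zoom `y ↦ x₀ + r y` of `ℝ³`, the time zoom `s ↦ T + l s` -/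

/-- Change of variables for Lebesgue measure under the space zoom `y ↦ x₀ + r y` of `ℝ³`. -/
theorem volume_preimage_zoomSpace {r : ℝ} (hr : 0 < r) (x₀ : E3) (F : Set E3) :
    volume ((fun y : E3 => x₀ + r • y) ⁻¹' F) = ENNReal.ofReal ((r ^ 3)⁻¹) * volume F := by
  have e : (fun y : E3 => x₀ + r • y) ⁻¹' F = (fun y : E3 => r • y) ⁻¹' ((fun z : E3 => x₀ + z) ⁻¹' F) := rfl
  rw [e, Measure.addHaar_preimage_smul volume hr.ne', measure_preimage_add, finrank_euclideanSpace,
    Fintype.card_fin, abs_of_nonneg (inv_nonneg.2 (pow_nonneg hr.le 3))]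

/-- Change of variables for Lebesgue measure under the time zoom `s ↦ T + l s`. -/
theorem volume_preimage_zoomTime {l : ℝ} (hl : 0 < l) (T : ℝ) (B : Set ℝ) :
    volume ((fun s : ℝ => T + l * s) ⁻¹' B) = ENNReal.ofReal l⁻¹ * volume B := by
  have e : (fun s : ℝ => T + l * s) ⁻¹' B = (fun s : ℝ => l * s) ⁻¹' ((fun t : ℝ => T + t) ⁻¹' B) := rfl
  rw [e, Real.volume_preimage_mul_left hl.ne', measure_preimage_add, abs_of_nonneg (inv_nonneg.2 hl.le)]

/-! ### Fatou for sets -/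

/-- **Fatou for sets**: a set each of whose points lies in `A j` for all large `j` has measure `≤ liminf_j μ(A j)`
(no measurability needed). -/
theorem measure_le_liminf_of_eventually_mem {X : Type*} [MeasurableSpace X] (μ : Measure X) {S : Set X}
    {A : ℕ → Set X} (h : ∀ x ∈ S, ∀ᶠ j in atTop, x ∈ A j) :
    μ S ≤ liminf (fun j => μ (A j)) atTop := by
  set D : ℕ → Set X := fun N => ⋂ j, ⋂ (_ : N ≤ j), A j with hD
  have hmono : Monotone D := by
    intro N N' hNN' x hx
    simp only [hD, mem_iInter] at hx ⊢
    exact fun j hj => hx j (hNN'.trans hj)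
  have hS : S ⊆ ⋃ N, D N := by
    intro x hx
    obtain ⟨N, hN⟩ := eventually_atTop.1 (h x hx)
    refine mem_iUnion.2 ⟨N, ?_⟩
    simp only [hD, mem_iInter]
    exact fun j hj => hN j hj
  calc μ S ≤ μ (⋃ N, D N) := measure_mono hS
    _ = ⨆ N, μ (D N) := hmono.measure_iUnion
    _ ≤ liminf (fun j => μ (A j)) atTop := by
        rw [liminf_eq_iSup_iInf_of_nat]
        refine iSup_mono fun N => le_iInf₂ fun j hj => measure_mono ?_
        intro x hx
        simp only [hD, mem_iInter] at hx
        exact hx j hj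

/-! ### The open limit fast set contains a box around each of its points -/

/-- A point of the open past with `κ < (−s₀)‖W(s₀, y₀)‖²` has a space–time box around it in the limit fast set
(joint continuity of `W ∈ 𝒦` on the open past). -/
theorem exists_box_fast {C : ℝ} {W : ℝ → E3 → E3} (hW : IsTypeIAncientMild C W) {κ s₀ : ℝ} (hs₀ : s₀ < 0)
    {y₀ : E3} (h : κ < -s₀ * ‖W s₀ y₀‖ ^ 2) :
    ∃ η : ℝ, 0 < η ∧ s₀ + η < 0 ∧
      ∀ s ∈ Ioo (s₀ - η) (s₀ + η), ∀ y ∈ ball y₀ η, κ < -s * ‖W s y‖ ^ 2 := by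
  have hcont : ContinuousOn (fun q : ℝ × E3 => -q.1 * ‖W q.1 q.2‖ ^ 2) (Iio 0 ×ˢ univ) := by
    have h1 : ContinuousOn (uncurry W) (Iio 0 ×ˢ univ) := hW.1.continuousOn
    have h2 : ContinuousOn (fun q : ℝ × E3 => ‖uncurry W q‖ ^ 2) (Iio 0 ×ˢ univ) := (h1.norm).pow 2
    exact (continuous_fst.neg.continuousOn).mul h2
  have hopen : IsOpen (Iio (0 : ℝ) ×ˢ (univ : Set E3)) := isOpen_Iio.prod isOpen_univ
  have hmem : (s₀, y₀) ∈ Iio (0 : ℝ) ×ˢ (univ : Set E3) := ⟨hs₀, mem_univ _⟩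
  have hat : ContinuousAt (fun q : ℝ × E3 => -q.1 * ‖W q.1 q.2‖ ^ 2) (s₀, y₀) :=
    hcont.continuousAt (hopen.mem_nhds hmem)
  have hnhd : {q : ℝ × E3 | κ < -q.1 * ‖W q.1 q.2‖ ^ 2} ∈ 𝓝 (s₀, y₀) :=
    hat.preimage_mem_nhds (isOpen_Ioi.mem_nhds h)
  obtain ⟨ε, hε, hball⟩ := Metric.mem_nhds_iff.1 hnhd
  refine ⟨min (ε / 2) (-s₀ / 2), lt_min (by linarith) (by linarith), ?_, ?_⟩
  · have : min (ε / 2) (-s₀ / 2) ≤ -s₀ / 2 := min_le_right _ _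
    linarith
  · intro s hs y hy
    have hsd : dist s s₀ < ε := by
      rw [Real.dist_eq]
      have h1 : min (ε / 2) (-s₀ / 2) ≤ ε / 2 := min_le_left _ _
      have := hs.1; have := hs.2
      rw [abs_sub_lt_iff]; constructor <;> linarith
    have hyd : dist y y₀ < ε := lt_of_lt_of_le (mem_ball.1 hy) ((min_le_left _ _).trans (by linarith))
    have hq : ((s, y) : ℝ × E3) ∈ ball ((s₀, y₀) : ℝ × E3) ε := by
      rw [mem_ball, Prod.dist_eq]
      exact max_lt hsd hyd
    exact hball hq

/-! ### THE SLICE-VOLUME TRANSFER (the heart of LINE 29) -/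

/-- **THE SLICE-VOLUME TRANSFER (NEW).**  In the singular-zoom frame (`FrozenTop.exists_singularZoom_package₃`: scales `c_j ↓ 0`,
`α R = β`, `α√ν = √β`, pointwise convergence to `W ∈ 𝒦`): if for EVERY fatness `δ > 0` the `δ`-fat times of the
`κ`-fast slice are NULL IN EVERY SCALE WINDOW at `T`, then the limit is `√κ`-SLOW EVERYWHERE, `(−s)‖W(s, y)‖² ≤ κ`.
Mechanism: a limit fast point has a fast box `I × B` (`exists_box_fast`); each of its points is eventually physically
fast (`eventually_fast_crit`), so by Fatou for sets `vol(B) ≤ liminf_j (c_jR)⁻³ vol(F_{t_j(s)})`, while the EXACT SCALING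
`(ν(T − t_j(s)))^{3/2} = (c_jR)³ (−s)^{3/2}` (`IntegratedStretch.sqrt_nu_timeLag`) turns this into: every `s ∈ I` has `t_j(s)` `δ`-fat
eventually (explicit `δ`); Fatou for sets in time then gives `vol(I) ≤ liminf_j vol{s ∈ I : t_j(s) fat}`
`≤ liminf_j vol(fat ∩ window_j)/λ_j = 0` (`λ_j = c_j²β`): contradiction with `vol(I) = 2η > 0`. -/
theorem slow_everywhere_of_scaleNull {T ν C : ℝ} {u : ℝ → E3 → E3} {x₀ : E3} {α β R : ℝ}
    {c : ℕ → ℝ} {W : ℝ → E3 → E3} (hν : 0 < ν) (hT : 0 < T) (hW : IsTypeIAncientMild C W)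
    (hα : 0 < α) (hβ : 0 < β) (hR : 0 < R) (hαR : α * R = β) (hαν : α * Real.sqrt ν = Real.sqrt β)
    (hcpos : ∀ j, 0 < c j) (hclim : Tendsto c atTop (𝓝 0))
    (hpt : ∀ t < 0, ∀ y : E3,
      Tendsto (fun j => (c j * α) • u (T + c j ^ 2 * β * t) (x₀ + (c j * R) • y)) atTop (𝓝 (W t y)))
    {κ : ℝ} (hκ : 0 ≤ κ) (hnull : ∀ δ : ℝ, 0 < δ → IsScaleNull T (fatTimes T ν κ δ u)) :
    ∀ s < (0 : ℝ), ∀ y : E3, -s * ‖W s y‖ ^ 2 ≤ κ := by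
  intro s₀ hs₀ y₀
  by_contra hnot
  obtain ⟨η, hη, hsη, hbox⟩ := exists_box_fast hW hs₀ (not_le.1 hnot)
  -- ### (1) space: every rescaled time of the box is eventually `δ`-fat, `δ = vol(B_η) / (2 (−s₀ + η)^{3/2})`
  have hmpos : 0 < volume (ball y₀ η) := measure_ball_pos volume y₀ hη
  have hmtop : volume (ball y₀ η) < ⊤ := measure_ball_lt_top
  have hmreal : 0 < (volume (ball y₀ η)).toReal := ENNReal.toReal_pos hmpos.ne' hmtop.ne
  have hσ₁ : 0 < -(s₀ - η) := by linarith
  have hsq₁ : 0 < Real.sqrt (-(s₀ - η)) ^ 3 := pow_pos (Real.sqrt_pos.2 hσ₁) 3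
  set δ : ℝ := (volume (ball y₀ η)).toReal / (2 * Real.sqrt (-(s₀ - η)) ^ 3) with hδdef
  have hδ : 0 < δ := div_pos hmreal (by positivity)
  have hfat : ∀ s ∈ Ioo (s₀ - η) (s₀ + η), ∀ᶠ j in atTop, T + c j ^ 2 * β * s ∈ fatTimes T ν κ δ u := by
    intro s hs
    have hs0 : s < 0 := by linarith [hs.2]
    have hs' : 0 < -s := neg_pos.2 hs0
    -- every point of the ball is eventually in the rescaled fast slice
    have hev : ∀ y ∈ ball y₀ η, ∀ᶠ j in atTop,
        y ∈ (fun y : E3 => x₀ + (c j * R) • y) ⁻¹' fastSlice T ν κ u (T + c j ^ 2 * β * s) := by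
      intro y hy
      exact (eventually_fast_crit hν hα hβ hαν hcpos hpt hκ hs0 (hbox s hs y hy)).mono fun j hj => hj
    have hFatou := measure_le_liminf_of_eventually_mem volume hev
    -- the explicit threshold is below `vol(B_η)`
    have hthr : ENNReal.ofReal (δ * Real.sqrt (-s) ^ 3) < volume (ball y₀ η) := by
      rw [ENNReal.ofReal_lt_iff_lt_toReal (by positivity) hmtop.ne]
      have hle : Real.sqrt (-s) ^ 3 ≤ Real.sqrt (-(s₀ - η)) ^ 3 :=
        pow_le_pow_left₀ (Real.sqrt_nonneg _) (Real.sqrt_le_sqrt (by linarith [hs.1])) 3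
      calc δ * Real.sqrt (-s) ^ 3 ≤ δ * Real.sqrt (-(s₀ - η)) ^ 3 := mul_le_mul_of_nonneg_left hle hδ.le
        _ = (volume (ball y₀ η)).toReal / 2 := by
            rw [hδdef]; field_simp
        _ < (volume (ball y₀ η)).toReal := by linarith
    have hev2 : ∀ᶠ j in atTop, ENNReal.ofReal (δ * Real.sqrt (-s) ^ 3) <
        volume ((fun y : E3 => x₀ + (c j * R) • y) ⁻¹' fastSlice T ν κ u (T + c j ^ 2 * β * s)) :=
      eventually_lt_of_lt_liminf (lt_of_lt_of_le hthr hFatou)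
    have hev3 : ∀ᶠ j in atTop, T + c j ^ 2 * β * s ∈ Ico 0 T :=
      (ColumnarTop.tendsto_physicalTime hβ hs0 hcpos hclim).eventually (Ico_mem_nhdsLT hT)
    filter_upwards [hev2, hev3] with j h2 h3
    refine ⟨h3, ?_⟩
    have hcR : 0 < c j * R := mul_pos (hcpos j) hR
    have hcR3 : 0 < (c j * R) ^ 3 := pow_pos hcR 3
    rw [volume_preimage_zoomSpace hcR x₀] at h2
    -- multiply through by `(c_j R)³`
    have hpv : parabVol T ν (T + c j ^ 2 * β * s) = ENNReal.ofReal ((c j * R) ^ 3 * Real.sqrt (-s) ^ 3) := by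
      unfold parabVol
      rw [IntegratedStretch.sqrt_nu_timeLag hν hα hβ hαR hαν hcpos j, mul_pow]
    have hne0 : ENNReal.ofReal ((c j * R) ^ 3) ≠ 0 := (ENNReal.ofReal_pos.2 hcR3).ne'
    have key := ENNReal.mul_lt_mul_right hne0 ENNReal.ofReal_ne_top h2
    rw [← ENNReal.ofReal_mul hcR3.le, ← mul_assoc (ENNReal.ofReal ((c j * R) ^ 3)), ← ENNReal.ofReal_mul hcR3.le,
      mul_inv_cancel₀ hcR3.ne', ENNReal.ofReal_one, one_mul] at key
    calc ENNReal.ofReal δ * parabVol T ν (T + c j ^ 2 * β * s)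
        = ENNReal.ofReal ((c j * R) ^ 3 * (δ * Real.sqrt (-s) ^ 3)) := by
          rw [hpv, ← ENNReal.ofReal_mul hδ.le]; congr 1; ring
      _ < volume (fastSlice T ν κ u (T + c j ^ 2 * β * s)) := key
  -- ### (2) time: Fatou for sets on the window `I` against the scale-null hypothesis along `λ_j = c_j² β`
  have hI := measure_le_liminf_of_eventually_mem volume
    (S := Ioo (s₀ - η) (s₀ + η))
    (A := fun j => Ioo (s₀ - η) (s₀ + η) ∩ (fun s : ℝ => T + c j ^ 2 * β * s) ⁻¹' fatTimes T ν κ δ u)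
    (fun s hs => (hfat s hs).mono fun j hj => ⟨hs, hj⟩)
  have ha : 0 < -(s₀ + η) := by linarith
  have hab : -(s₀ + η) < -(s₀ - η) := by linarith
  have hl : ∀ j, 0 < c j ^ 2 * β := fun j => mul_pos (pow_pos (hcpos j) 2) hβ
  have hsub : ∀ j, Ioo (s₀ - η) (s₀ + η) ∩ (fun s : ℝ => T + c j ^ 2 * β * s) ⁻¹' fatTimes T ν κ δ u ⊆
      (fun s : ℝ => T + c j ^ 2 * β * s) ⁻¹'
        (fatTimes T ν κ δ u ∩ Icc (T - c j ^ 2 * β * -(s₀ - η)) (T - c j ^ 2 * β * -(s₀ + η))) := by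
    intro j s hs
    refine ⟨hs.2, ?_, ?_⟩
    · show T - c j ^ 2 * β * -(s₀ - η) ≤ T + c j ^ 2 * β * s
      nlinarith [hl j, hs.1.1]
    · show T + c j ^ 2 * β * s ≤ T - c j ^ 2 * β * -(s₀ + η)
      nlinarith [hl j, hs.1.2]
  have hvolS : ∀ j, volume (Ioo (s₀ - η) (s₀ + η) ∩ (fun s : ℝ => T + c j ^ 2 * β * s) ⁻¹' fatTimes T ν κ δ u) ≤
      volume (fatTimes T ν κ δ u ∩ Icc (T - c j ^ 2 * β * -(s₀ - η)) (T - c j ^ 2 * β * -(s₀ + η))) /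
        ENNReal.ofReal (c j ^ 2 * β) := by
    intro j
    calc volume (Ioo (s₀ - η) (s₀ + η) ∩ (fun s : ℝ => T + c j ^ 2 * β * s) ⁻¹' fatTimes T ν κ δ u)
        ≤ volume ((fun s : ℝ => T + c j ^ 2 * β * s) ⁻¹'
            (fatTimes T ν κ δ u ∩ Icc (T - c j ^ 2 * β * -(s₀ - η)) (T - c j ^ 2 * β * -(s₀ + η)))) :=
          measure_mono (hsub j)
      _ = ENNReal.ofReal (c j ^ 2 * β)⁻¹ *
            volume (fatTimes T ν κ δ u ∩ Icc (T - c j ^ 2 * β * -(s₀ - η)) (T - c j ^ 2 * β * -(s₀ + η))) :=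
          volume_preimage_zoomTime (hl j) T _
      _ = volume (fatTimes T ν κ δ u ∩ Icc (T - c j ^ 2 * β * -(s₀ - η)) (T - c j ^ 2 * β * -(s₀ + η))) /
            ENNReal.ofReal (c j ^ 2 * β) := by
          rw [ENNReal.ofReal_inv_of_pos (hl j), mul_comm, div_eq_mul_inv]
  have hl0 : Tendsto (fun j => c j ^ 2 * β) atTop (𝓝[>] (0 : ℝ)) := by
    refine tendsto_nhdsWithin_iff.2 ⟨?_, Eventually.of_forall fun j => hl j⟩
    have h := (hclim.pow 2).mul_const β
    rw [zero_pow two_ne_zero, zero_mul] at h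
    exact h
  have hlim0 := (hnull δ hδ (-(s₀ + η)) (-(s₀ - η)) ha hab).comp hl0
  have hliminf0 : liminf (fun j => volume (Ioo (s₀ - η) (s₀ + η) ∩
      (fun s : ℝ => T + c j ^ 2 * β * s) ⁻¹' fatTimes T ν κ δ u)) atTop ≤ 0 := by
    calc liminf (fun j => volume (Ioo (s₀ - η) (s₀ + η) ∩
            (fun s : ℝ => T + c j ^ 2 * β * s) ⁻¹' fatTimes T ν κ δ u)) atTop
        ≤ liminf (fun j => volume (fatTimes T ν κ δ u ∩
            Icc (T - c j ^ 2 * β * -(s₀ - η)) (T - c j ^ 2 * β * -(s₀ + η))) / ENNReal.ofReal (c j ^ 2 * β)) atTop :=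
          liminf_le_liminf (Eventually.of_forall hvolS)
      _ = 0 := hlim0.liminf_eq
  have hI0 : volume (Ioo (s₀ - η) (s₀ + η)) = 0 := le_antisymm (hI.trans hliminf0) bot_le
  have hIpos : 0 < volume (Ioo (s₀ - η) (s₀ + η)) := by
    rw [Real.volume_Ioo]
    exact ENNReal.ofReal_pos.2 (by linarith)
  exact absurd hI0 hIpos.ne'

/-! ### The KILL, imported by name from the tree's threshold table of `𝒦` (T31⁗, no decay hypothesis) -/

/-- **Type-I ancient mild fields that are `√κ`-SLOW EVERYWHERE, `κ < 1`, are trivial** — the tree's time-constant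
threshold `SimilarityEnstrophy.typeI_ancient_eq_zero_of_timeConstant_lt_one_noDecay` (`√(−t)‖V‖ ≤ θ < 1` everywhere ⇒
`V ≡ 0`; every class constant; no decay hypothesis), read with `θ = √κ₊`.  No kill is proved in this file. -/
theorem slow_ancient_trivial {C κ : ℝ} (hκ : κ < 1) {W : ℝ → E3 → E3} (hW : IsTypeIAncientMild C W)
    (h : ∀ s < (0 : ℝ), ∀ y : E3, -s * ‖W s y‖ ^ 2 ≤ κ) : ∀ s < (0 : ℝ), ∀ y : E3, W s y = 0 := by
  refine SimilarityEnstrophy.typeI_ancient_eq_zero_of_timeConstant_lt_one_noDecay (sqrt_max_lt_one hκ) hW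
    (fun t ht x => ?_)
  have ht' : 0 < -t := neg_pos.2 ht
  refine le_of_sq_le_sq ?_ (Real.sqrt_nonneg _)  -- (Mathlib)
  rw [mul_pow, Real.sq_sqrt ht'.le, Real.sq_sqrt (le_max_right _ _)]
  exact (h t ht x).trans (le_max_left _ _)

end Summit.NavierStokesRegularity.NavierStokesRegularity.Theorems.ScenarioCensus.ThinTop

end
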